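import Literature.RingTheory.Henselian.HenselianOfIdempotentLifting
import HarnessLib

/-!
# Henselian local rings: the localisations `S_𝔫` of a finite algebra are henselian (Stacks 04GH, localisation form)

Topic `Literature/RingTheory/Henselian`; namespace `Literature.RingTheory.Henselian`.  PROOF FILE (theorems only; no
definition, no named fact, no instance, no `sorry`).  Cell `hodgecm-mathlib` (D-0151); idle-hand generic capital, sequel of
★ `Henselian/FiniteAlgebraProductOfLocalizations` (04GG (1) ⇒ (10), `S ≅ Π_𝔫 S_𝔫`) and ★ `Henselian/HenselianOfIdempotentLifting`
(the local corners `S ⧸ (1 - e_𝔫)` are henselian).  Here the two are put together in the form printed in [Stacks 04GH]: «if `R` is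
henselian and `S` is a finite `R`-algebra then `S` is a finite product of henselian local rings — THE LOCALISATIONS AT THE MAXIMAL
IDEALS».

* §1 `isLocalization_atPrime_quotient_span_one_sub` — for an idempotent `e₀` of a commutative ring `S` with `e₀ ≡ 1 (mod 𝔫₀)`
  for one maximal ideal `𝔫₀` and `e₀ ∈ 𝔫` for every other maximal ideal `𝔫`, the corner `S ⧸ (1 - e₀)` IS the localisation
  `S_{𝔫₀}` (`IsLocalization.AtPrime`); with ★ `isLocalRing_quotient_span_one_sub`.
* §2 `henselianLocalRing_of_ringEquiv` — the henselian property transports along ring isomorphisms of local rings.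
* §3 **`henselianLocalRing_localization_atPrime`** — for `S` module-finite over a henselian local ring `R` and a maximal ideal
  `𝔫` of `S`, the local ring `S_𝔫` is henselian. [Stacks 04GH]

HC_CM is proved only modulo the 7 printed citations until rung 0 closes; this file is generic commutative algebra.

## References
* [StacksProject] The Stacks project, Tag 04GH = Algebra, Lemma 10.153.4 (a finite algebra over a henselian local ring is a finite
  product of henselian local rings, namely its localisations at maximal ideals); Tag 04GF = Definition 10.153.1 (henselian local
  ring); Tag 00EE (= Lemma 10.21.1: idempotents and the decomposition `R = Re × R(1-e)`; the corner is the localisation at `e`).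
-/

set_option autoImplicit false

noncomputable section

universe u v w

open Polynomial IsLocalRing

namespace Literature.RingTheory.Henselian

/-! ## §1 The corner at a separating idempotent is the localisation at the maximal ideal -/

/-- **The corner `S ⧸ (1 - e₀)` is the localisation `S_{𝔫₀}`** when the idempotent `e₀` satisfies `e₀ ≡ 1 (mod 𝔫₀)` and lies in
every other maximal ideal: `S ⧸ (1 - e₀) = S[e₀⁻¹]` (Mathlib `IsLocalization.Away.quotient_of_isIdempotentElem`) is local with
maximal ideal the image of `𝔫₀` (★ `isLocalRing_quotient_span_one_sub`), so every element of `S ∖ 𝔫₀` is already invertible there.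
[cite: StacksProject, Tag 00EE] [cite: StacksProject, Tag 04GH] -/
theorem isLocalization_atPrime_quotient_span_one_sub {S : Type v} [CommRing S] (e₀ : S) (he₀ : IsIdempotentElem e₀)
    (𝔫₀ : Ideal S) [h𝔫₀ : 𝔫₀.IsMaximal] (h₀ : e₀ - 1 ∈ 𝔫₀) (h : ∀ 𝔫 : Ideal S, 𝔫.IsMaximal → 𝔫 ≠ 𝔫₀ → e₀ ∈ 𝔫) :
    IsLocalization.AtPrime (S ⧸ Ideal.span {1 - e₀}) 𝔫₀ := by
  haveI : IsLocalization.Away e₀ (S ⧸ Ideal.span {1 - e₀}) := IsLocalization.Away.quotient_of_isIdempotentElem he₀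
  obtain ⟨hloc, hmax⟩ := isLocalRing_quotient_span_one_sub e₀ 𝔫₀ h₀ h
  haveI := hloc
  have hne : e₀ ∉ 𝔫₀ := fun hmem => h𝔫₀.ne_top ((Ideal.eq_top_iff_one _).2 (by
    have := 𝔫₀.sub_mem hmem h₀; rwa [sub_sub_cancel] at this))
  refine IsLocalization.of_le (Submonoid.powers e₀) 𝔫₀.primeCompl ?_ fun r hr => ?_
  · rw [Submonoid.powers_le]
    exact hne
  · rw [Ideal.Quotient.algebraMap_eq]
    by_contra hunit
    have hmem : Ideal.Quotient.mk (Ideal.span {1 - e₀}) r ∈ maximalIdeal (S ⧸ Ideal.span {1 - e₀}) := by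
      rw [mem_maximalIdeal, mem_nonunits_iff]; exact hunit
    rw [← eq_maximalIdeal hmax, ← Ideal.mem_comap, Ideal.comap_map_of_surjective _ Ideal.Quotient.mk_surjective,
      ← RingHom.ker_eq_comap_bot, Ideal.mk_ker, sup_eq_left.2 ?_] at hmem
    · exact hr hmem
    · rw [Ideal.span_le, Set.singleton_subset_iff]
      have := 𝔫₀.neg_mem h₀
      rwa [neg_sub] at this

/-! ## §2 Transport of the henselian property along ring isomorphisms -/

/-- The henselian property of local rings is invariant under ring isomorphisms (bookkeeping on [Stacks 04GF]: roots and
simple roots of the transported monic polynomial correspond). [cite: StacksProject, Tag 04GF] -/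
theorem henselianLocalRing_of_ringEquiv {A : Type v} {B : Type w} [CommRing A] [CommRing B] [HenselianLocalRing A]
    [IsLocalRing B] (ε : A ≃+* B) : HenselianLocalRing B := by
  refine { toIsLocalRing := inferInstance, is_henselian := fun f hf b₀ hfb₀ hf'b₀ => ?_ }
  -- pull back to `A`
  have hunitA : ∀ a : A, IsUnit (ε a) → IsUnit a := fun a ha => by
    simpa using ha.map ε.symm
  have hmaxB : ∀ b : B, b ∈ maximalIdeal B → ε.symm b ∈ maximalIdeal A := fun b hb => by
    rw [mem_maximalIdeal, mem_nonunits_iff] at hb ⊢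
    exact fun hu => hb (by simpa using hu.map ε)
  have hmaxA : ∀ a : A, a ∈ maximalIdeal A → ε a ∈ maximalIdeal B := fun a ha => by
    rw [mem_maximalIdeal, mem_nonunits_iff] at ha ⊢
    exact fun hu => ha (hunitA a hu)
  set g : A[X] := f.map (ε.symm : B →+* A) with hg
  have hgm : g.Monic := hf.map _
  have hgf : g.map (ε : A →+* B) = f := by
    rw [hg, Polynomial.map_map]
    have : (ε : A →+* B).comp (ε.symm : B →+* A) = RingHom.id B := by
      ext b; simp
    rw [this, Polynomial.map_id]
  have hevalf : ∀ a : A, f.eval (ε a) = ε (g.eval a) := fun a => by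
    conv_lhs => rw [← hgf]
    rw [eval_map]
    exact eval₂_hom (ε : A →+* B) a
  have hevalf' : ∀ a : A, f.derivative.eval (ε a) = ε (g.derivative.eval a) := fun a => by
    conv_lhs => rw [← hgf]
    rw [derivative_map, eval_map]
    exact eval₂_hom (ε : A →+* B) a
  have hga₀ : g.eval (ε.symm b₀) ∈ maximalIdeal A := by
    have := hmaxB _ hfb₀
    rwa [← ε.apply_symm_apply b₀, hevalf, ε.symm_apply_apply] at this
  have hg'a₀ : IsUnit (g.derivative.eval (ε.symm b₀)) := by
    refine hunitA _ ?_
    rw [← hevalf', ε.apply_symm_apply]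
    exact hf'b₀
  obtain ⟨a, hga, haa₀⟩ := HenselianLocalRing.is_henselian g hgm (ε.symm b₀) hga₀ hg'a₀
  refine ⟨ε a, ?_, ?_⟩
  · rw [IsRoot.def, hevalf, hga.eq_zero, map_zero]
  · have := hmaxA _ haa₀
    rwa [map_sub, ε.apply_symm_apply] at this

/-! ## §3 The localisations of a finite algebra over a henselian local ring are henselian — Stacks 04GH -/

/-- **`S_𝔫` is henselian** [Stacks 04GH, printed form]: for `S` module-finite over a henselian local ring `R` and `𝔫` a maximal
ideal of `S`, the local ring `Localization.AtPrime 𝔫` is henselian (it is the corner `S ⧸ (1 - e_𝔫)` of ★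
`exists_completeOrthogonalIdempotents_maximalSpectrum`, henselian by ★ `henselianLocalRing_quotient_span_one_sub`).
[cite: StacksProject, Tag 04GH] -/
theorem henselianLocalRing_localization_atPrime (R : Type u) [CommRing R] [HenselianLocalRing R] {S : Type v} [CommRing S]
    [Algebra R S] [Module.Finite R S] (𝔫 : Ideal S) [h𝔫 : 𝔫.IsMaximal] : HenselianLocalRing (Localization.AtPrime 𝔫) := by
  classical
  haveI : Fintype (MaximalSpectrum S) :=
    @Fintype.ofFinite _ (Literature.RingTheory.Idempotents.finite_maximalSpectrum (R := R) (A := S))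
  obtain ⟨e, he, he1, he0⟩ := exists_completeOrthogonalIdempotents_maximalSpectrum R (S := S)
  set 𝔫' : MaximalSpectrum S := ⟨𝔫, h𝔫⟩ with h𝔫'
  have hsep : ∀ 𝔫₁ : Ideal S, 𝔫₁.IsMaximal → 𝔫₁ ≠ 𝔫 → e 𝔫' ∈ 𝔫₁ := fun 𝔫₁ h𝔫₁ hne =>
    he0 𝔫' ⟨𝔫₁, h𝔫₁⟩ (fun h' => hne (congrArg MaximalSpectrum.asIdeal h').symm)
  haveI : IsLocalRing (S ⧸ Ideal.span {1 - e 𝔫'}) := (isLocalRing_quotient_span_one_sub (e 𝔫') 𝔫 (he1 𝔫') hsep).1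
  haveI : IsLocalization.AtPrime (S ⧸ Ideal.span {1 - e 𝔫'}) 𝔫 :=
    isLocalization_atPrime_quotient_span_one_sub (e 𝔫') (he.idem 𝔫') 𝔫 (he1 𝔫') hsep
  haveI : HenselianLocalRing (S ⧸ Ideal.span {1 - e 𝔫'}) := henselianLocalRing_quotient_span_one_sub R (e 𝔫')
  exact henselianLocalRing_of_ringEquiv
    (IsLocalization.algEquiv 𝔫.primeCompl (S ⧸ Ideal.span {1 - e 𝔫'}) (Localization.AtPrime 𝔫)).toRingEquiv

end Literature.RingTheory.Henselian

end
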